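import Summits.AtomisticToContinuum.HydrodynamicLimit.Theorems.RelayRaceLocalityLightConeInLawDoDConeLemma
import Summits.AtomisticToContinuum.HydrodynamicLimit.Theorems.RelayRaceLocalityLightConeInLawDoDFluxBound
import Summits.AtomisticToContinuum.HydrodynamicLimit.Theorems.RelayRaceLocalityLightConeInLawDoDRescale
import Summits.AtomisticToContinuum.HydrodynamicLimit.Theorems.RelayRaceLocalityLightConeInLawSandwich
import Literature.MathematicalPhysics.KineticTheory.HardSphereCanonicalTorus
import Summits.AtomisticToContinuum.HydrodynamicLimit.Theorems.ImplosionDichotomyHsEosLowDensity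

/-!
# Finite domain of dependence for classical hard-sphere Euler solutions on `𝕋³` (reduced units),
# and the core of the crux `LightConeInLaw` below the generalised conjunct
(stmt-AtomisticToContinuum-12500, line `Sketch`, `--supports`; route `RelayRaceLocality`,
sub-problem `HydrodynamicLimit`; lead c1)

Third of three files (after `…DoDWeight.lean`, `…DoDConeLemma.lean`) DISCHARGING the PDE
hypothesis (DoD) of `Sandwich.stub_core_of_hydroLimitGeneral_of_coneUniqueness`
((HL-gen) → (DoD) → `stub_core`): classical solutions of the hard-sphere compressible Euler
system on `𝕋³` have a finite domain of dependence, in reduced units and uniformly in the reduced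
diameter (Dafermos 2005, Ch. V, Thm 5.2.1, cone form (5.2.1), classical-vs-classical, weighted
relative-energy method):

* `relFlux_dom` — flux domination under the guards `θ ≤ M`, `‖u‖ ≤ M`, `Z, Z + ηZ' ≤ 3/2` with
  `s = M + 2√(3M/2)` (stub `flux_dot_le` of `…DoDFluxBound.lean`);
* `reducedConeUniqueness_of_eos` — under the low-density equation-of-state hypothesis
  (`hsExcessFreeEnergy = F` on `[0, η₀)`, `F` analytic), `∃ η₂ ∀ M ∃ c(M)`: two classical
  solutions (reduced diameters `σ₁, σ₂`) guarded on `[0, t]` whose reduced data `(ρσ³, U, Θ)`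
  agree on `B(x₀, R)` agree in reduced units on `B(x₀, R - c t)` at time `t` — both reduced
  triples solve the `σ = 1` system (`hsEuler_rescale`, `hsEuler_restrict` of `…DoDRescale.lean`),
  the cone lemma `cone_unique_of_smooth_eos` is centred at each target point with
  `a₀ = 2(R - dist(x, x₀))` (its pseudo-ball lies in `B(x₀, R)` as `Q ≥ 4 dist²`), which absorbs
  the distortion between `Q` and `dist²` into `c = 2s + 1`; continuity in time at the endpoint;
* `reducedConeUniqueness` — UNCONDITIONAL: the equation-of-state hypothesis is the tree's theorem
  `hsEosLowDensity_proof` (`ImplosionDichotomy.HsEosLowDensity`, stmt-0768);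
* `stub_core_of_hydroLimitGeneral` — hence the registered stub `stub_core` of the line follows from
  (HL-gen) ALONE (the packing-guarded hydrodynamic limit for general comparison families).

Reference: C. M. Dafermos, *Hyperbolic Conservation Laws in Continuum Physics*, 2nd ed. (2005),
Ch. V §5.2, Thm 5.2.1 (held: `book:dafermos2005-…`, p. 126). [Dafermos2005]
-/

namespace Summit.AtomisticToContinuum.HydrodynamicLimit.Theorems.LightConeInLawSketch.DoD

open scoped BigOperators Topology Classical ENNReal
open Filter Set MeasureTheory
open Literature.MathematicalPhysics.KineticTheory Literature.Analysis.FluidPDE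
  Literature.Analysis.FunctionSpaces

noncomputable section

open HsEulerCalc

/-! ### Flux domination along guarded solutions -/

/-- **Flux domination under the guards.** For reduced density `r > 0`, temperature
`0 < θ ≤ M`, hyperbolicity coefficient `0 < γ ≤ 3/2` (`γ = ζ + rζ'`), compressibility `|ζ| ≤ 3/2`
and velocity `‖u‖ ≤ M`, the relative-energy flux `Φ` of the difference with any second state
`(r', u', θ')` is dominated by the energy `e`: `|ν · Φ| ≤ ‖ν‖ (M + 2√(3M/2)) e` for every `ν`
(`flux_dot_le` with `S₁ = S₂ = √(3M/2)`). -/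
theorem relFlux_dom {r θ r' θ' γ ζ M : ℝ} {u u' : V3} (hr : 0 < r) (hθ : 0 < θ) (hθM : θ ≤ M)
    (hγ0 : 0 < γ) (hγ : γ ≤ 3 / 2) (hζ : |ζ| ≤ 3 / 2) (hu : ‖u‖ ≤ M) (ν : Fin 3 → ℝ) :
    |∑ i, ν i * (1 / 2 * (θ * γ / r * u i * (r - r') ^ 2 + r * u i * ‖u - u'‖ ^ 2 +
          3 / 2 * r / θ * u i * (θ - θ') ^ 2) +
        θ * γ * (r - r') * (u i - u' i) + r * ζ * (θ - θ') * (u i - u' i))| ≤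
      Real.sqrt (∑ i, ν i ^ 2) * (M + 2 * Real.sqrt (3 * M / 2)) *
        (1 / 2 * (θ * γ / r * (r - r') ^ 2 + r * ‖u - u'‖ ^ 2 + 3 / 2 * r / θ * (θ - θ') ^ 2)) := by
  have hM : 0 < M := hθ.trans_le hθM
  -- the norm of a vector of `V3 = ℝ³` is the root of the sum of squares of its coordinates
  have norm_V3_eq_sqrt : ∀ v : V3, ‖v‖ = Real.sqrt (∑ i, v i ^ 2) := fun v => by
    rw [EuclideanSpace.norm_eq]
    congr 1
    exact Finset.sum_congr rfl fun i _ => by rw [Real.norm_eq_abs, sq_abs]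
  have hnw : ‖u - u'‖ ^ 2 = ∑ j, (u j - u' j) ^ 2 := by
    rw [norm_V3_eq_sqrt, Real.sq_sqrt (Finset.sum_nonneg fun j _ => sq_nonneg _)]
    rfl
  have hA : 0 ≤ θ * γ / r := by positivity
  have hB : 0 ≤ 3 / 2 * r / θ := by positivity
  have hS : 0 ≤ Real.sqrt (3 * M / 2) := Real.sqrt_nonneg _
  have hS2 : Real.sqrt (3 * M / 2) ^ 2 = 3 * M / 2 := Real.sq_sqrt (by positivity)
  have hP : (θ * γ) ^ 2 ≤ Real.sqrt (3 * M / 2) ^ 2 * (θ * γ / r * r) := by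
    rw [hS2, div_mul_cancel₀ _ hr.ne']
    have h1 : θ * γ ≤ M * (3 / 2) := mul_le_mul hθM hγ hγ0.le hM.le
    nlinarith [mul_pos hθ hγ0]
  have hR : (r * ζ) ^ 2 ≤ Real.sqrt (3 * M / 2) ^ 2 * (3 / 2 * r / θ * r) := by
    rw [hS2]
    have hζ2 : ζ ^ 2 ≤ (3 / 2) ^ 2 := by
      have := abs_le.1 hζ
      nlinarith
    have h2 : 3 * M / 2 * (3 / 2 * r / θ * r) = r ^ 2 * (9 / 4 * (M / θ)) := by
      field_simp
      ring
    rw [mul_pow, h2]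
    refine mul_le_mul_of_nonneg_left ?_ (sq_nonneg _)
    have hMθ : 1 ≤ M / θ := by rw [le_div_iff₀ hθ]; linarith
    nlinarith
  have h := flux_dot_le (θ * γ / r) r (3 / 2 * r / θ) (θ * γ) (r * ζ) (Real.sqrt (3 * M / 2))
    (Real.sqrt (3 * M / 2)) (r - r') (θ - θ') (fun i => u i) (fun i => u i - u' i) ν hA hr.le hB
    hS hS hP hR
  have hu' : Real.sqrt (∑ i, u i ^ 2) ≤ M := by rw [← norm_V3_eq_sqrt]; exact hu
  have he : 0 ≤ 1 / 2 * (θ * γ / r * (r - r') ^ 2 + r * ∑ j, (u j - u' j) ^ 2 +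
      3 / 2 * r / θ * (θ - θ') ^ 2) := by
    have : 0 ≤ ∑ j, (u j - u' j) ^ 2 := Finset.sum_nonneg fun j _ => sq_nonneg _
    positivity
  rw [hnw]
  calc _ ≤ Real.sqrt (∑ i, ν i ^ 2) * (Real.sqrt (∑ i, u i ^ 2) + Real.sqrt (3 * M / 2) +
        Real.sqrt (3 * M / 2)) * (1 / 2 * (θ * γ / r * (r - r') ^ 2 +
          r * ∑ j, (u j - u' j) ^ 2 + 3 / 2 * r / θ * (θ - θ') ^ 2)) := h
    _ ≤ Real.sqrt (∑ i, ν i ^ 2) * (M + 2 * Real.sqrt (3 * M / 2)) * (1 / 2 *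
          (θ * γ / r * (r - r') ^ 2 + r * ∑ j, (u j - u' j) ^ 2 +
            3 / 2 * r / θ * (θ - θ') ^ 2)) := by
      refine mul_le_mul_of_nonneg_right (mul_le_mul_of_nonneg_left (by linarith)
        (Real.sqrt_nonneg _)) he

/-! ### A one-sided continuity tool -/

/-- Two functions that agree on `[0, t)` (`t > 0`) and are continuous at `t` within `[0, T₁)`
resp. `[0, T₂)` (`t < T₁`, `t < T₂`) agree at `t`. -/
theorem eq_of_eqOn_Ico {X : Type*} [TopologicalSpace X] [T2Space X] {f g : ℝ → X}
    {t T₁ T₂ : ℝ} (ht : 0 < t) (ht₁ : t < T₁) (ht₂ : t < T₂)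
    (hf : ContinuousWithinAt f (Ico 0 T₁) t) (hg : ContinuousWithinAt g (Ico 0 T₂) t)
    (h : ∀ s ∈ Ico 0 t, f s = g s) : f t = g t := by
  have hf' : ContinuousWithinAt f (Ico 0 t) t := hf.mono (Ico_subset_Ico_right ht₁.le)
  have hg' : ContinuousWithinAt g (Ico 0 t) t := hg.mono (Ico_subset_Ico_right ht₂.le)
  haveI : (𝓝[Ico 0 t] t).NeBot := by
    refine mem_closure_iff_nhdsWithin_neBot.1 ?_
    rw [closure_Ico ht.ne]
    exact right_mem_Icc.2 ht.le
  have hfg : Tendsto g (𝓝[Ico 0 t] t) (𝓝 (f t)) :=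
    hf'.tendsto.congr' (eventually_nhdsWithin_of_forall fun s hs => h s hs)
  exact tendsto_nhds_unique hfg hg'.tendsto

/-! ### Reduced cone uniqueness (finite domain of dependence) under the equation-of-state hypothesis -/

/-- **Finite domain of dependence for classical hard-sphere Euler solutions, in reduced units,
under the low-density equation-of-state hypothesis** (Dafermos 2005, Thm 5.2.1, the cone
`(5.2.1)`, classical-vs-classical case, for the hard-sphere system on `𝕋³`). If
`hsExcessFreeEnergy = F` on `[0, η₀)` with `F` analytic on `(-η₀, η₀)`, there is `η₂ > 0` and, for
every bound `M > 0`, a speed `c = c(M) > 0` such that: two classical solutions, with reduced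
diameters `σ₁, σ₂ > 0`, whose packings stay `< η₂` and whose temperatures and speeds stay
`≤ M` on `[0, t]`, and whose REDUCED data `(ρσ³, U, Θ)` agree at time `0` on the ball `B(x₀, R)`
of the minimal-image distance, agree in reduced units at time `t` on `B(x₀, R − c t)`. Proof: both
reduced triples `(ρᵢσᵢ³, Uᵢ, Θᵢ)` are classical solutions of the `σ = 1` system
(`hsEuler_rescale`), restricted to `[0, t)` (`hsEuler_restrict`); the system is symmetrisable
hyperbolic with `Z, Z + ηZ' ∈ (1/2, 3/2)` at packing `< η₂`; under the guards the relative-energy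
fluxes are dominated with `s = M + 2√(3M/2)` (`relFlux_dom`); the cone lemma
`cone_unique_of_smooth_eos` centred at the target point `x` with `a₀ = 2(R − dist(x, x₀))`
(its pseudo-ball lies in `B(x₀, R)` because `Q ≥ 4 dist²` and the triangle inequality) gives
agreement at `(t', x)` for all `t' < t` since `π s t < 2 c t < a₀` for `c = 2 s + 1`; continuity
in time finishes. [cite: Dafermos2005, Thm 5.2.1] -/
theorem reducedConeUniqueness_of_eos :
    ∀ η₀ : ℝ, 0 < η₀ → ∀ F : ℝ → ℝ, AnalyticOnNhd ℝ F (Ioo (-η₀) η₀) →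
      EqOn hsExcessFreeEnergy F (Ico 0 η₀) →
    ∃ η₂ : ℝ, 0 < η₂ ∧ ∀ M : ℝ, 0 < M → ∃ c : ℝ, 0 < c ∧
      ∀ (σ₁ σ₂ : ℝ), 0 < σ₁ → 0 < σ₂ →
      ∀ (T₁ T₂ : ℝ) (ρ₁ Θ₁ ρ₂ Θ₂ : ℝ → T3 → ℝ) (U₁ U₂ : ℝ → T3 → V3),
        IsHardSphereEulerSolution σ₁ T₁ ρ₁ U₁ Θ₁ → IsHardSphereEulerSolution σ₂ T₂ ρ₂ U₂ Θ₂ →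
      ∀ t : ℝ, 0 ≤ t → t < T₁ → t < T₂ →
        (∀ s ∈ Set.Icc 0 t, ∀ x, ρ₁ s x * σ₁ ^ 3 < η₂ ∧ Θ₁ s x ≤ M ∧ ‖U₁ s x‖ ≤ M ∧
          ρ₂ s x * σ₂ ^ 3 < η₂ ∧ Θ₂ s x ≤ M ∧ ‖U₂ s x‖ ≤ M) →
      ∀ (x₀ : T3) (R : ℝ),
        (∀ x, Torus.euclidDist x x₀ < R →
          ρ₁ 0 x * σ₁ ^ 3 = ρ₂ 0 x * σ₂ ^ 3 ∧ U₁ 0 x = U₂ 0 x ∧ Θ₁ 0 x = Θ₂ 0 x) →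
      ∀ x, Torus.euclidDist x x₀ < R - c * t →
        ρ₁ t x * σ₁ ^ 3 = ρ₂ t x * σ₂ ^ 3 ∧ U₁ t x = U₂ t x ∧ Θ₁ t x = Θ₂ t x := by
  intro η₀ hη₀ F hF hEq
  obtain ⟨Zf, hZf⟩ : ∃ Zf : ℝ → ℝ, Zf = fun η => 1 + η * deriv F η := ⟨_, rfl⟩
  have hFc : ContDiffOn ℝ (⊤ : ℕ∞) F (Ioo (-η₀) η₀) := hF.contDiffOn_of_completeSpace
  have hZc : ContDiffOn ℝ (⊤ : ℕ∞) Zf (Ioo (-η₀) η₀) := by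
    rw [hZf]
    exact contDiffOn_const.add (contDiffOn_id.mul (hFc.deriv_of_isOpen isOpen_Ioo le_rfl))
  have hZd : ContDiffOn ℝ (⊤ : ℕ∞) (deriv Zf) (Ioo (-η₀) η₀) := hZc.deriv_of_isOpen isOpen_Ioo le_rfl
  have h0mem : (0 : ℝ) ∈ Ioo (-η₀) η₀ := ⟨by linarith, hη₀⟩
  -- `Z` and `Z + ηZ'` are continuous at packing `0` with value `1`
  have hZ0 : ContinuousAt Zf 0 := hZc.continuousOn.continuousAt (isOpen_Ioo.mem_nhds h0mem)
  have hgc : ContinuousAt (fun η => Zf η + η * deriv Zf η) 0 :=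
    hZ0.add (continuousAt_id.mul (hZd.continuousOn.continuousAt (isOpen_Ioo.mem_nhds h0mem)))
  have hZ00 : Zf 0 = 1 := by simp [hZf]
  have hg0 : Zf 0 + 0 * deriv Zf 0 = 1 := by simp [hZf]
  have hev : ∀ᶠ η in 𝓝 (0 : ℝ), Zf η ∈ Ioo (1 / 2 : ℝ) (3 / 2) ∧
      Zf η + η * deriv Zf η ∈ Ioo (1 / 2 : ℝ) (3 / 2) := by
    have hI : Ioo (1 / 2 : ℝ) (3 / 2) ∈ 𝓝 (1 : ℝ) := Ioo_mem_nhds (by norm_num) (by norm_num)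
    have h1 : Zf ⁻¹' Ioo (1 / 2) (3 / 2) ∈ 𝓝 (0 : ℝ) := hZ0.preimage_mem_nhds (by rw [hZ00]; exact hI)
    have h2 : (fun η => Zf η + η * deriv Zf η) ⁻¹' Ioo (1 / 2) (3 / 2) ∈ 𝓝 (0 : ℝ) :=
      hgc.preimage_mem_nhds (by show Ioo (1 / 2 : ℝ) (3 / 2) ∈ 𝓝 (Zf 0 + 0 * deriv Zf 0); rw [hg0]; exact hI)
    filter_upwards [h1, h2] with η hη1 hη2 using ⟨hη1, hη2⟩
  obtain ⟨δ, hδ, hδg⟩ := Metric.eventually_nhds_iff.1 hev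
  set η₂ : ℝ := min (η₀ / 2) (δ / 2) with hη₂
  have hη₂pos : 0 < η₂ := by positivity
  have hη₂η₀ : η₂ < η₀ := (min_le_left _ _).trans_lt (by linarith)
  have hη₂δ : η₂ < δ := (min_le_right _ _).trans_lt (by linarith)
  refine ⟨η₂, hη₂pos, fun M hM => ?_⟩
  set s : ℝ := M + 2 * Real.sqrt (3 * M / 2) with hs
  have hs0 : 0 ≤ s := by positivity
  refine ⟨2 * s + 1, by positivity, ?_⟩
  intro σ₁ σ₂ hσ₁ hσ₂ T₁ T₂ ρ₁ Θ₁ ρ₂ Θ₂ U₁ U₂ hsol₁ hsol₂ t ht0 htT₁ htT₂ hguard x₀ R hagree x hx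
  rcases ht0.eq_or_lt with rfl | htpos
  · exact hagree x (by simpa using hx)
  -- facts about `ζ = Z` on the packing range `[0, η₂]`
  have hab : Icc 0 η₂ ⊆ Ioo (-η₀) η₀ := fun r hr => ⟨by linarith [hr.1], hr.2.trans_lt hη₂η₀⟩
  have hrange : ∀ r ∈ Icc (0 : ℝ) η₂, Zf r ∈ Ioo (1 / 2 : ℝ) (3 / 2) ∧
      Zf r + r * deriv Zf r ∈ Ioo (1 / 2 : ℝ) (3 / 2) := fun r hr =>
    hδg (by rw [dist_zero_right, Real.norm_eq_abs, abs_of_nonneg hr.1]; exact hr.2.trans_lt hη₂δ)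
  have hγ : ∀ r ∈ Icc (0 : ℝ) η₂, 0 < Zf r + r * deriv Zf r := fun r hr =>
    lt_trans (by norm_num) (hrange r hr).2.1
  -- the reduced solutions restricted to `[0, t)`
  have hE₁ := hsEuler_restrict (hsEuler_rescale hσ₁ hsol₁) htT₁.le
  have hE₂ := hsEuler_restrict (hsEuler_rescale hσ₂ hsol₂) htT₂.le
  have hIco : ∀ t' ∈ Ico 0 t, t' ∈ Icc 0 t := fun t' ht' => Ico_subset_Icc_self ht'
  have hρab₁ : ∀ t' ∈ Ico 0 t, ∀ z, (fun t z => ρ₁ t z * σ₁ ^ 3) t' z ∈ Icc 0 η₂ := fun t' ht' z =>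
    ⟨(mul_pos (hsol₁.density_pos t' ⟨ht'.1, ht'.2.trans htT₁⟩ z) (pow_pos hσ₁ 3)).le,
      (hguard t' (hIco t' ht') z).1.le⟩
  have hρab₂ : ∀ t' ∈ Ico 0 t, ∀ z, (fun t z => ρ₂ t z * σ₂ ^ 3) t' z ∈ Icc 0 η₂ := fun t' ht' z =>
    ⟨(mul_pos (hsol₂.density_pos t' ⟨ht'.1, ht'.2.trans htT₂⟩ z) (pow_pos hσ₂ 3)).le,
      (hguard t' (hIco t' ht') z).2.2.2.1.le⟩
  -- pressure laws of the reduced solutions: `hsPressure 1 r θ = r θ Z(r)`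
  have hpr : ∀ r θ : ℝ, 0 < r → r < η₂ → hsPressure 1 r θ = r * θ * Zf r := by
    intro r θ hr0 hrη
    have hη : r ∈ Ioo 0 η₀ := ⟨hr0, hrη.trans hη₂η₀⟩
    show r * θ * hsCompressibility (r * 1 ^ 3) = r * θ * Zf r
    rw [one_pow, mul_one, hsCompressibility_eq hEq hη, hZf]
  have hp₁ : ∀ t' ∈ Ico 0 t, ∀ z, hsPressure 1 ((fun t z => ρ₁ t z * σ₁ ^ 3) t' z) (Θ₁ t' z) =
      (fun t z => ρ₁ t z * σ₁ ^ 3) t' z * Θ₁ t' z * Zf ((fun t z => ρ₁ t z * σ₁ ^ 3) t' z) :=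
    fun t' ht' z => hpr _ _ (mul_pos (hsol₁.density_pos t' ⟨ht'.1, ht'.2.trans htT₁⟩ z) (pow_pos hσ₁ 3))
      (hguard t' (hIco t' ht') z).1
  have hp₂ : ∀ t' ∈ Ico 0 t, ∀ z, hsPressure 1 ((fun t z => ρ₂ t z * σ₂ ^ 3) t' z) (Θ₂ t' z) =
      (fun t z => ρ₂ t z * σ₂ ^ 3) t' z * Θ₂ t' z * Zf ((fun t z => ρ₂ t z * σ₂ ^ 3) t' z) :=
    fun t' ht' z => hpr _ _ (mul_pos (hsol₂.density_pos t' ⟨ht'.1, ht'.2.trans htT₂⟩ z) (pow_pos hσ₂ 3))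
      (hguard t' (hIco t' ht') z).2.2.2.1
  -- flux domination with the constant `s` on `[0, t) × 𝕋³`
  have hdom : ∀ t' ∈ Ico 0 t, ∀ z, ∀ ν : Fin 3 → ℝ,
      |∑ i, ν i * (1 / 2 * (Θ₁ t' z * (Zf (ρ₁ t' z * σ₁ ^ 3) +
            ρ₁ t' z * σ₁ ^ 3 * deriv Zf (ρ₁ t' z * σ₁ ^ 3)) / (ρ₁ t' z * σ₁ ^ 3) * U₁ t' z i *
              (ρ₁ t' z * σ₁ ^ 3 - ρ₂ t' z * σ₂ ^ 3) ^ 2 +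
            ρ₁ t' z * σ₁ ^ 3 * U₁ t' z i * ‖U₁ t' z - U₂ t' z‖ ^ 2 +
            3 / 2 * (ρ₁ t' z * σ₁ ^ 3) / Θ₁ t' z * U₁ t' z i * (Θ₁ t' z - Θ₂ t' z) ^ 2) +
          Θ₁ t' z * (Zf (ρ₁ t' z * σ₁ ^ 3) + ρ₁ t' z * σ₁ ^ 3 * deriv Zf (ρ₁ t' z * σ₁ ^ 3)) *
            (ρ₁ t' z * σ₁ ^ 3 - ρ₂ t' z * σ₂ ^ 3) * (U₁ t' z i - U₂ t' z i) +
          ρ₁ t' z * σ₁ ^ 3 * Zf (ρ₁ t' z * σ₁ ^ 3) * (Θ₁ t' z - Θ₂ t' z) * (U₁ t' z i - U₂ t' z i))| ≤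
        Real.sqrt (∑ i, ν i ^ 2) * s * (1 / 2 *
          (Θ₁ t' z * (Zf (ρ₁ t' z * σ₁ ^ 3) + ρ₁ t' z * σ₁ ^ 3 * deriv Zf (ρ₁ t' z * σ₁ ^ 3)) /
              (ρ₁ t' z * σ₁ ^ 3) * (ρ₁ t' z * σ₁ ^ 3 - ρ₂ t' z * σ₂ ^ 3) ^ 2 +
            ρ₁ t' z * σ₁ ^ 3 * ‖U₁ t' z - U₂ t' z‖ ^ 2 +
            3 / 2 * (ρ₁ t' z * σ₁ ^ 3) / Θ₁ t' z * (Θ₁ t' z - Θ₂ t' z) ^ 2)) := by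
    intro t' ht' z ν
    have htT₁' : t' ∈ Ico 0 T₁ := ⟨ht'.1, ht'.2.trans htT₁⟩
    obtain ⟨hg1, hg2, hg3, -, -, -⟩ := hguard t' (hIco t' ht') z
    have hr0 : 0 < ρ₁ t' z * σ₁ ^ 3 := mul_pos (hsol₁.density_pos t' htT₁' z) (pow_pos hσ₁ 3)
    have hrr := hrange _ (hρab₁ t' ht' z)
    exact relFlux_dom hr0 (hsol₁.temperature_pos t' htT₁' z) hg2 (hγ _ (hρab₁ t' ht' z))
      hrr.2.2.le (abs_le.2 ⟨by linarith [hrr.1.1], hrr.1.2.le⟩) hg3 ν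
  -- the pseudo-ball of parameter `a₀ = 2 (R - dist(x, x₀))` centred at `x`
  set a₀ : ℝ := 2 * (R - Torus.euclidDist x x₀) with ha₀
  have hct : (2 * s + 1) * t < R - Torus.euclidDist x x₀ := by linarith
  have ha₀t : Real.pi * s * t < a₀ := by
    have hπ : Real.pi * s * t ≤ 4 * s * t :=
      mul_le_mul_of_nonneg_right (mul_le_mul_of_nonneg_right (by linarith [Real.pi_lt_four]) hs0) htpos.le
    nlinarith
  have ha₀pos : 0 < a₀ := lt_of_le_of_lt (by positivity) ha₀t
  have h0 : ∀ z, ∑ i : Fin 3, Real.sin (Real.pi * ‖(z - x) i‖) ^ 2 < a₀ ^ 2 →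
      (fun t z => ρ₁ t z * σ₁ ^ 3) 0 z = (fun t z => ρ₂ t z * σ₂ ^ 3) 0 z ∧
        U₁ 0 z = U₂ 0 z ∧ Θ₁ 0 z = Θ₂ 0 z := by
    intro z hz
    have h4 := four_mul_euclidDist_sq_le_qdist z x
    have hd : Torus.euclidDist z x < a₀ / 2 := by
      have h1 : (2 * Torus.euclidDist z x) ^ 2 < a₀ ^ 2 := by nlinarith
      have h2 : 2 * Torus.euclidDist z x < a₀ := lt_of_pow_lt_pow_left₀ 2 ha₀pos.le h1
      linarith
    have hzx₀ : Torus.euclidDist z x₀ < R := by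
      have htri := euclidDist_triangle z x x₀
      have : a₀ / 2 = R - Torus.euclidDist x x₀ := by rw [ha₀]; ring
      linarith
    exact hagree z hzx₀
  have hcone := cone_unique_of_smooth_eos hE₁ hE₂ isOpen_Ioo hZc hab hγ hρab₁ hρab₂ hp₁ hp₂ hs0
    ha₀t.le hdom h0
  -- agreement at the centre for all earlier times
  have heq : ∀ t' ∈ Ico 0 t, ρ₁ t' x * σ₁ ^ 3 = ρ₂ t' x * σ₂ ^ 3 ∧ U₁ t' x = U₂ t' x ∧
      Θ₁ t' x = Θ₂ t' x := by
    intro t' ht'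
    refine hcone t' ht' x ?_
    have hQ0 : ∑ i : Fin 3, Real.sin (Real.pi * ‖(x - x) i‖) ^ 2 = 0 := by simp
    rw [hQ0]
    have : Real.pi * s * t' < a₀ := lt_of_le_of_lt
      (mul_le_mul_of_nonneg_left ht'.2.le (by positivity)) ha₀t
    nlinarith
  -- continuity in time at `t`
  have ht₁ : t ∈ Ico 0 T₁ := ⟨ht0, htT₁⟩
  have ht₂ : t ∈ Ico 0 T₂ := ⟨ht0, htT₂⟩
  refine ⟨?_, ?_, ?_⟩
  · exact eq_of_eqOn_Ico (f := fun τ => ρ₁ τ x * σ₁ ^ 3) (g := fun τ => ρ₂ τ x * σ₂ ^ 3) htpos htT₁ htT₂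
      ((hsol₁.smooth_density.hasDerivWithinAt_slice ht₁ x).continuousWithinAt.mul
        continuousWithinAt_const)
      ((hsol₂.smooth_density.hasDerivWithinAt_slice ht₂ x).continuousWithinAt.mul
        continuousWithinAt_const) fun s hs => (heq s hs).1
  · exact eq_of_eqOn_Ico (f := fun τ => U₁ τ x) (g := fun τ => U₂ τ x) htpos htT₁ htT₂
      (hsol₁.smooth_velocity.hasDerivWithinAt_slice ht₁ x).continuousWithinAt
      (hsol₂.smooth_velocity.hasDerivWithinAt_slice ht₂ x).continuousWithinAt fun s hs => (heq s hs).2.1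
  · exact eq_of_eqOn_Ico (f := fun τ => Θ₁ τ x) (g := fun τ => Θ₂ τ x) htpos htT₁ htT₂
      (hsol₁.smooth_temperature.hasDerivWithinAt_slice ht₁ x).continuousWithinAt
      (hsol₂.smooth_temperature.hasDerivWithinAt_slice ht₂ x).continuousWithinAt fun s hs => (heq s hs).2.2


/-! ### The PDE leg discharged: the equation of state IS analytic at low density (tree) -/

/-- **Finite domain of dependence for classical hard-sphere Euler solutions in reduced units —
UNCONDITIONAL.** Hypothesis (DoD) of `Sandwich.stub_core_of_hydroLimitGeneral_of_coneUniqueness`,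
verbatim, discharged: the low-density equation-of-state hypothesis of
`reducedConeUniqueness_of_eos` is the tree's theorem `hsEosLowDensity_proof`
(`ImplosionDichotomy.HsEosLowDensity`, stmt-AtomisticToContinuum-0768: `hsExcessFreeEnergy` is
real-analytic at small packing). [cite: Dafermos2005, Thm 5.2.1] -/
theorem reducedConeUniqueness :
    (∃ η₂ : ℝ, 0 < η₂ ∧ ∀ M : ℝ, 0 < M → ∃ c : ℝ, 0 < c ∧
      ∀ (σ₁ σ₂ : ℝ), 0 < σ₁ → 0 < σ₂ →
      ∀ (T₁ T₂ : ℝ) (ρ₁ Θ₁ ρ₂ Θ₂ : ℝ → T3 → ℝ) (U₁ U₂ : ℝ → T3 → V3),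
        IsHardSphereEulerSolution σ₁ T₁ ρ₁ U₁ Θ₁ → IsHardSphereEulerSolution σ₂ T₂ ρ₂ U₂ Θ₂ →
      ∀ t : ℝ, 0 ≤ t → t < T₁ → t < T₂ →
        (∀ s ∈ Set.Icc 0 t, ∀ x, ρ₁ s x * σ₁ ^ 3 < η₂ ∧ Θ₁ s x ≤ M ∧ ‖U₁ s x‖ ≤ M ∧
          ρ₂ s x * σ₂ ^ 3 < η₂ ∧ Θ₂ s x ≤ M ∧ ‖U₂ s x‖ ≤ M) →
      ∀ (x₀ : T3) (R : ℝ),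
        (∀ x, Torus.euclidDist x x₀ < R →
          ρ₁ 0 x * σ₁ ^ 3 = ρ₂ 0 x * σ₂ ^ 3 ∧ U₁ 0 x = U₂ 0 x ∧ Θ₁ 0 x = Θ₂ 0 x) →
      ∀ x, Torus.euclidDist x x₀ < R - c * t →
        ρ₁ t x * σ₁ ^ 3 = ρ₂ t x * σ₂ ^ 3 ∧ U₁ t x = U₂ t x ∧ Θ₁ t x = Θ₂ t x) := by
  obtain ⟨η₀, hη₀, F, hF, hEq, -⟩ := hsEosLowDensity_proof
  exact reducedConeUniqueness_of_eos η₀ hη₀ F hF hEq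

/-- **The core of the crux below the generalised conjunct alone.** With the PDE leg discharged
(`reducedConeUniqueness`), the registered stub `stub_core` of the line `Sketch` follows from the
single macroscopic hypothesis (HL-gen): the packing-guarded hydrodynamic limit for general
comparison families `(ε N, n N)` with `n N · (ε N)³ → σ³`, `ε N → 0` (the body of
`HydroLimitInBand`, stmt-AtomisticToContinuum-3093, for the comparison families of the crux).
Registered sub-goal; the conclusion is the signature of `stub_core` verbatim. -/
theorem stub_core_of_hydroLimitGeneral :
    (∃ η₁ : ℝ, 0 < η₁ ∧
      ∀ (a θ : T3 → ℝ) (u : T3 → V3), Continuous a → Continuous θ → Continuous u →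
        (∀ x, 0 < a x) → (∀ x, 0 < θ x) →
      ∃ σ₀ : ℝ, 0 < σ₀ ∧ ∀ σ : ℝ, 0 < σ → σ < σ₀ →
      ∀ (ε : ℕ → ℝ) (n : ℕ → ℕ), (∀ N, 0 < ε N) → Tendsto ε atTop (𝓝 0) →
        Tendsto (fun N => (n N : ℝ) * ε N ^ 3) atTop (𝓝 (σ ^ 3)) →
      ∀ (T : ℝ) (ρ Θ : ℝ → T3 → ℝ) (U : ℝ → T3 → V3), IsHardSphereEulerSolution σ T ρ U Θ →
      ∀ Φ : (N : ℕ) → HardSphereFlow G3 (ε N) (n N),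
      (∀ N, IsProbabilityMeasure
        (particleLaw (Φ N) (canonicalDensity G3 (ε N) (n N) (localGibbsProfile a u θ)))) →
      LLNAt n (fun N => particleLaw (Φ N)
        (canonicalDensity G3 (ε N) (n N) (localGibbsProfile a u θ))) Φ (ρ 0) (U 0) (Θ 0) 0 →
      ∀ t : ℝ, 0 ≤ t → t < T → (∀ s ∈ Set.Icc 0 t, ∀ x, ρ s x * σ ^ 3 < η₁) →
      LLNAt n (fun N => particleLaw (Φ N)
        (canonicalDensity G3 (ε N) (n N) (localGibbsProfile a u θ))) Φ (ρ t) (U t) (Θ t) t) →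
    ∃ η₀ : ℝ, 0 < η₀ ∧ ∀ M : ℝ, 0 < M → ∃ c : ℝ, 0 < c ∧
    ∀ (a₁ θ₁ a₂ θ₂ : T3 → ℝ) (u₁ u₂ : T3 → V3), Continuous a₁ → Continuous θ₁ → Continuous u₁ →
      Continuous a₂ → Continuous θ₂ → Continuous u₂ → (∀ x, 0 < a₁ x) → (∀ x, 0 < θ₁ x) →
      (∀ x, 0 < a₂ x) → (∀ x, 0 < θ₂ x) →
    ∃ σ₀ : ℝ, 0 < σ₀ ∧ ∀ (σ₁ σ₂ : ℝ), 0 < σ₁ → σ₁ < σ₀ → 0 < σ₂ → σ₂ < σ₀ →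
    ∀ n₂ : ℕ → ℕ, Tendsto (fun N => (n₂ N : ℝ) * hsDiameter σ₁ N ^ 3) atTop (𝓝 (σ₂ ^ 3)) →
    ∀ (T₁ T₂ : ℝ) (ρ₁ Θ₁ ρ₂ Θ₂ : ℝ → T3 → ℝ) (U₁ U₂ : ℝ → T3 → V3),
      IsHardSphereEulerSolution σ₁ T₁ ρ₁ U₁ Θ₁ → IsHardSphereEulerSolution σ₂ T₂ ρ₂ U₂ Θ₂ →
    ∀ (Φ₁ : (N : ℕ) → HardSphereFlow G3 (hsDiameter σ₁ N) (N + 1))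
      (Φ₂ : (N : ℕ) → HardSphereFlow G3 (hsDiameter σ₁ N) (n₂ N)),
    (∀ N, IsProbabilityMeasure (localGibbsLaw σ₁ a₁ u₁ θ₁ N (Φ₁ N))) →
    (∀ N, IsProbabilityMeasure (particleLaw (Φ₂ N)
      (canonicalDensity G3 (hsDiameter σ₁ N) (n₂ N) (localGibbsProfile a₂ u₂ θ₂)))) →
    TendstoHydroFieldsAt (fun N => localGibbsLaw σ₁ a₁ u₁ θ₁ N (Φ₁ N)) Φ₁ ρ₁ U₁ Θ₁ 0 →
    LLNAt n₂ (fun N => particleLaw (Φ₂ N)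
      (canonicalDensity G3 (hsDiameter σ₁ N) (n₂ N) (localGibbsProfile a₂ u₂ θ₂))) Φ₂
      (ρ₂ 0) (U₂ 0) (Θ₂ 0) 0 →
    (∀ x, U₁ 0 x = u₁ x ∧ Θ₁ 0 x = θ₁ x) → (∀ x, U₂ 0 x = u₂ x ∧ Θ₂ 0 x = θ₂ x) →
    ∀ t : ℝ, 0 < t → t < T₁ → t < T₂ →
      (∀ s ∈ Set.Icc 0 t, ∀ x, ρ₁ s x * σ₁ ^ 3 < η₀ ∧ Θ₁ s x ≤ M ∧ ‖U₁ s x‖ ≤ M ∧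
        ρ₂ s x * σ₂ ^ 3 < η₀ ∧ Θ₂ s x ≤ M ∧ ‖U₂ s x‖ ≤ M) →
    ∀ (x₀ : T3) (R : ℝ), 0 < R - c * t →
      (∀ x, Torus.euclidDist x x₀ < R →
        ρ₁ 0 x * σ₁ ^ 3 = ρ₂ 0 x * σ₂ ^ 3 ∧ U₁ 0 x = U₂ 0 x ∧ Θ₁ 0 x = Θ₂ 0 x) →
    ∀ χ : T3 → ℝ, Continuous χ → (∀ x, R - c * t ≤ Torus.euclidDist x x₀ → χ x = 0) →
    ∀ F : ℝ × V3 × ℝ → ℝ, LipschitzWith 1 F → (∀ p, |F p| ≤ 1) →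
      Tendsto (fun N =>
        (∫ z, F (σ₁ ^ 3 * empiricalDensityField ((Φ₁ N).flow t z) χ,
            (σ₁ ^ 3) • empiricalMomentumField ((Φ₁ N).flow t z) χ,
            σ₁ ^ 3 * empiricalEnergyField ((Φ₁ N).flow t z) χ) ∂(localGibbsLaw σ₁ a₁ u₁ θ₁ N (Φ₁ N))) -
        ∫ z, F (σ₂ ^ 3 * empiricalDensityField ((Φ₂ N).flow t z) χ,
            (σ₂ ^ 3) • empiricalMomentumField ((Φ₂ N).flow t z) χ,
            σ₂ ^ 3 * empiricalEnergyField ((Φ₂ N).flow t z) χ) ∂(particleLaw (Φ₂ N)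
              (canonicalDensity G3 (hsDiameter σ₁ N) (n₂ N) (localGibbsProfile a₂ u₂ θ₂)))) atTop (𝓝 0) := fun hHL =>
  Sandwich.stub_core_of_hydroLimitGeneral_of_coneUniqueness hHL reducedConeUniqueness

end

end Summit.AtomisticToContinuum.HydrodynamicLimit.Theorems.LightConeInLawSketch.DoD
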